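import Summits.Parity.BatemanHorn.Theorems.AlmostPrimeZerosDefs
import Summits.Parity.BatemanHorn.Theorems.SystemLSDRealSegment.Negative.OmegaWide

/-!
# `SystemLSDRealSegment`, line `beta-thinned-root-kernel` — the hypothesis `1 ≤ y` of `stub_typeISandwich`
# is load-bearing (the sandwich AS TYPED is false at `y = 0` for the Bateman–Horn system `f = X`)

Negative-side support for the crux `Summit.Parity.BatemanHorn.Theses.AlmostPrimeZeros.SystemLSDRealSegment`
(stmt-Parity-11292), registered stub `stub_typeISandwich` of the checked skeleton
`Cruxes/SystemLSDRealSegment/Lines/beta-thinned-root-kernel.lean` (vocabulary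
`Theorems/AlmostPrimeZerosDefs.lean`):
`∀ k f, IsBatemanHornSystem f → ∀ y : ℝ, 1 ≤ y → TypeISandwich k f y`, where
`TypeISandwich k f y := ∃ C, ∀ x, |T_x(y) − (x+1) Σ_{m≤x} b(m)| ≤ C (1 + Σ_{m≤x} m·b(m))`.

The right-hand side is SIGNED: for `y < 1` the thinned weight `h_y(p) = y − 1` is negative, `b(m)` takes both
signs, and `1 + Σ_{m ≤ x} m b(m)` can vanish while the left-hand side does not.  Witness: `f = X`, `y = 0`
(`h_0 = μ`, `b(m) = μ(m)/m`): at `x = 3`, `T_3(0) = 2`, `(x+1)Σ_{m≤3} b(m) = 4(1 − 1/2 − 1/3) = 2/3`,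
`1 + Σ_{m≤3} m b(m) = 1 + (1 − 1 − 1) = 0`, so the inequality reads `4/3 ≤ 0`.  Hence the stub with `1 ≤ y`
dropped is false (`stub_typeISandwich_false_without_one_le`); any proof of the stub must use `1 ≤ y` (it is
what makes `h_y ≥ 0`, `b ≥ 0`, and the error `≤ (n₀+2) Σ m b(m)` an upper bound).  The computation doubles as a
non-junk-model check of the vocabulary (`tuples`, `divSet`, `prodTuples`, `tupleCount`, `tupleLcm`, `bCoeff`,
`typeISum` evaluate as intended on `f = X`).
-/

open Polynomial Finset
open scoped BigOperators

namespace Summit.Parity.BatemanHorn.Theorems.SystemLSDRealSegment.Negative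

open Literature.NumberTheory.Sieve
open Summit.Parity.BatemanHorn.Cruxes.SystemLSDRealSegment.BetaThinnedRootKernel

/-! ### The Type-I coefficient of `f = X` at `y = 0`: `b(1) = 1`, `b(2) = −1/2`, `b(3) = −1/3` -/

/-- `tupleCount X (m) = 1` for `m = 1, 2, 3` (the only solution of `m ∣ n`, `n < m`, is `n = 0`) and
`tupleLcm (m) = m`, so `tupleDens X (m) = 1/m`; here `m = 1`. [folklore] -/
theorem tupleDens_X_one : tupleDens ![(X : ℤ[X])] ![1] = 1 := by
  unfold tupleDens tupleCount
  rw [show tupleLcm ![(1 : ℕ)] = 1 from by decide]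
  simp

/-- `tupleDens X (2) = 1/2`. [folklore] -/
theorem tupleDens_X_two : tupleDens ![(X : ℤ[X])] ![2] = 1 / 2 := by
  unfold tupleDens tupleCount
  rw [show tupleLcm ![(2 : ℕ)] = 2 from by decide]
  have : ((range 2).filter fun n : ℕ => ∀ i : Fin 1, (((![(2 : ℕ)] : Fin 1 → ℕ) i : ℕ) : ℤ) ∣
      ((![(X : ℤ[X])] : Fin 1 → ℤ[X]) i).eval (n : ℤ)) = {0} := by
    ext n
    simp only [mem_filter, mem_range, mem_singleton, Fin.forall_fin_one, Matrix.cons_val_zero, eval_X,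
      Int.natCast_dvd_natCast]
    constructor
    · rintro ⟨hn, h⟩
      interval_cases n
      · rfl
      · exact absurd h (by decide)
    · rintro rfl
      exact ⟨by norm_num, dvd_zero 2⟩
  rw [this, card_singleton]
  norm_num

/-- `tupleDens X (3) = 1/3`. [folklore] -/
theorem tupleDens_X_three : tupleDens ![(X : ℤ[X])] ![3] = 1 / 3 := by
  unfold tupleDens tupleCount
  rw [show tupleLcm ![(3 : ℕ)] = 3 from by decide]
  have : ((range 3).filter fun n : ℕ => ∀ i : Fin 1, (((![(3 : ℕ)] : Fin 1 → ℕ) i : ℕ) : ℤ) ∣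
      ((![(X : ℤ[X])] : Fin 1 → ℤ[X]) i).eval (n : ℤ)) = {0} := by
    ext n
    simp only [mem_filter, mem_range, mem_singleton, Fin.forall_fin_one, Matrix.cons_val_zero, eval_X,
      Int.natCast_dvd_natCast]
    constructor
    · rintro ⟨hn, h⟩
      interval_cases n
      · rfl
      · exact absurd h (by decide)
      · exact absurd h (by decide)
    · rintro rfl
      exact ⟨by norm_num, dvd_zero 3⟩
  rw [this, card_singleton]
  norm_num

/-- `h_0(2) = −1` (`h_0 = μ`). [folklore] -/
theorem thinWeight_zero_two : thinWeight (0 : ℝ) 2 = -1 := by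
  rw [thinWeight_prime (0 : ℝ) Nat.prime_two]; norm_num

/-- `h_0(3) = −1`. [folklore] -/
theorem thinWeight_zero_three : thinWeight (0 : ℝ) 3 = -1 := by
  rw [thinWeight_prime (0 : ℝ) Nat.prime_three]; norm_num

/-- `b_{X,0}(1) = 1`. [folklore] -/
theorem bCoeff_X_zero_one : bCoeff ![(X : ℤ[X])] 0 1 = 1 := by
  unfold bCoeff
  rw [show prodTuples 1 1 = {![1]} from by decide, sum_singleton, Fin.prod_univ_one, Matrix.cons_val_zero,
    thinWeight_one, tupleDens_X_one, one_mul]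

/-- `b_{X,0}(2) = −1/2`. [folklore] -/
theorem bCoeff_X_zero_two : bCoeff ![(X : ℤ[X])] 0 2 = -1 / 2 := by
  unfold bCoeff
  rw [show prodTuples 1 2 = {![2]} from by decide, sum_singleton, Fin.prod_univ_one, Matrix.cons_val_zero,
    thinWeight_zero_two, tupleDens_X_two]
  norm_num

/-- `b_{X,0}(3) = −1/3`. [folklore] -/
theorem bCoeff_X_zero_three : bCoeff ![(X : ℤ[X])] 0 3 = -1 / 3 := by
  unfold bCoeff
  rw [show prodTuples 1 3 = {![3]} from by decide, sum_singleton, Fin.prod_univ_one, Matrix.cons_val_zero,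
    thinWeight_zero_three, tupleDens_X_three]
  norm_num

/-! ### The Type-I sum of `f = X` at `y = 0`, `x = 3`: `T_3(0) = 2` -/

/-- The divisor tuples of `f = X` at `n` are the singletons `(a)`, `a ∈ divSet n`. [folklore] -/
theorem tuples_X (n : ℕ) :
    tuples ![(X : ℤ[X])] n = (divSet n).image fun a : ℕ => (fun _ : Fin 1 => a) := by
  ext d
  simp only [tuples, Fintype.mem_piFinset, Fin.forall_fin_one, Matrix.cons_val_zero, eval_X, Int.toNat_natCast,
    mem_image]
  constructor
  · intro h
    exact ⟨d 0, h, funext fun i => by rw [Fin.fin_one_eq_zero i]⟩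
  · rintro ⟨a, ha, rfl⟩
    exact ha

/-- Inner sum of `T_x(y)` for `f = X` as a sum over `divSet n`. [folklore] -/
theorem innerSum_X (y : ℝ) (n x : ℕ) :
    ∑ d ∈ (tuples ![(X : ℤ[X])] n).filter (fun d => ∏ i, d i ≤ x), ∏ i, thinWeight y (d i) =
      ∑ a ∈ (divSet n).filter (fun a => a ≤ x), thinWeight y a := by
  rw [tuples_X, filter_image, sum_image]
  · simp only [Fin.prod_univ_one]
  · intro a _ b _ h
    exact congr_fun h 0

/-- `T_3(0) = 2` for `f = X`: `n = 0, 1` give `h(1) = 1` each, `n = 2, 3` give `h(1) + h(p) = 0`. [folklore] -/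
theorem typeISum_X_zero_three : typeISum ![(X : ℤ[X])] 0 3 = 2 := by
  unfold typeISum
  simp only [innerSum_X]
  rw [show (3 + 1 : ℕ) = 4 from rfl, Finset.sum_range_succ, Finset.sum_range_succ, Finset.sum_range_succ,
    Finset.sum_range_one]
  rw [show (divSet 0).filter (fun a => a ≤ 3) = {1} from by decide,
    show (divSet 1).filter (fun a => a ≤ 3) = {1} from by decide,
    show (divSet 2).filter (fun a => a ≤ 3) = {1, 2} from by decide,
    show (divSet 3).filter (fun a => a ≤ 3) = {1, 3} from by decide]
  rw [sum_singleton, sum_pair (by norm_num), sum_pair (by norm_num), thinWeight_one, thinWeight_zero_two,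
    thinWeight_zero_three]
  norm_num

/-! ### The refutations -/

/-- **The sandwich as typed is false at `y = 0` for `f = X`**: at `x = 3` it reads `|2 − 2/3| ≤ C · 0`.
[folklore] -/
theorem not_typeISandwich_X_zero : ¬ TypeISandwich 1 ![(X : ℤ[X])] 0 := by
  rintro ⟨C, hC⟩
  have h := hC 3
  have hIcc : (Icc 1 3 : Finset ℕ) = {1, 2, 3} := by decide
  rw [typeISum_X_zero_three, hIcc, sum_insert (by decide), sum_pair (by decide), sum_insert (by decide),
    sum_pair (by decide), bCoeff_X_zero_one, bCoeff_X_zero_two, bCoeff_X_zero_three] at h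
  norm_num at h

/-- **`1 ≤ y` is load-bearing in `stub_typeISandwich`**: the stub with that hypothesis dropped,
`∀ k f, IsBatemanHornSystem f → ∀ y, TypeISandwich k f y`, is false (witness `k = 1`, `f = X`, `y = 0`, `x = 3`).
[folklore] -/
theorem stub_typeISandwich_false_without_one_le :
    ¬ ∀ (k : ℕ) (f : Fin k → ℤ[X]), IsBatemanHornSystem f → ∀ y : ℝ, TypeISandwich k f y :=
  fun h => not_typeISandwich_X_zero (h 1 ![X] isBatemanHornSystem_X 0)

end Summit.Parity.BatemanHorn.Theorems.SystemLSDRealSegment.Negative
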